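import Summits.MatrixMultiplication.MatrixMultiplication.Theses.DesignFlattening

/-!
# Refutation of `DesignFlattening.SeparableDesignsMultiplicative` (stmt-MatrixMultiplication-8036)

The statement claims that every separable `k`-term toric design of `xyz^{⊗N}` over the `ℤ₃` table has
`k ≥ 2^N`.  At `N = 2` there is a separable design with `k = 3 < 4`: all its entries lie in `ℚ(√-3)`;
cleared of denominators (`12` on the first factors, `42` on the second, `168` on the third) it becomes
the integral identity `84672² · (xyz ⊗ xyz) = Σ_{j<3} term_j ⊗ term_j` over `ℤ[√-3]`, checked on all
`3⁶` entries by `decide`, and transported to `ℂ` along `√-3 ↦ i√3`.  (Found by Levenberg–Marquardt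
search plus greedy pinning of coordinates; the card had left `k ∈ {3,4}` at `N = 2` open.)
Since rev 5 of the route file (2026-08-15) the refuted decl `DesignFlattening.SeparableDesignsMultiplicative`
is no longer declared there; it is re-declared below (ledger signature verbatim) so that the
refutation keeps elaborating.
-/

namespace Summit.MatrixMultiplication.MatrixMultiplication.Theses.DesignFlattening

/-- The former crux `SeparableDesignsMultiplicative` of route DesignFlattening
(stmt-MatrixMultiplication-8036, card K3 "separable designs are multiplicative"): every separable
`k`-term toric design of `xyz^{⊗N}` over the `ℤ₃` table — `xyz^{⊗N}(a,b,c) = Σ_{j<k} Π_{i<N}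
[aᵢ+bᵢ+cᵢ=0]·u_{ji}(aᵢ) v_{ji}(bᵢ) w_{ji}(cᵢ)` — has `k ≥ 2^N`. REFUTED by
`DesignFlatteningSeparableDesignsMultiplicative_refuted` below (a separable `3`-term design at
`N = 2`); the route file dropped the decl at rev 5 (2026-08-15T17:49:09Z, after the refutation closed
the item; the refuted record is kept there as a comment), so it is re-declared here, in the route's
namespace and with the item's ledger signature verbatim, solely so that the refutation keeps
elaborating unchanged (a definition recording a refuted statement, not a cited fact). -/
def SeparableDesignsMultiplicative : Prop :=
  ∀ (N k : ℕ) (u v w : Fin k → Fin N → Fin 3 → ℂ),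
    (∀ a b c : Fin N → Fin 3,
      Literature.Computability.AlgebraicComplexity.kroneckerPow
          (Literature.Computability.AlgebraicComplexity.xyzTensor ℂ) N a b c =
        ∑ j, ∏ i, ((if a i + b i + c i = 0 then (1 : ℂ) else 0) * u j i (a i) * v j i (b i) * w j i (c i))) →
    (2 : ℝ) ^ N ≤ (k : ℝ)

end Summit.MatrixMultiplication.MatrixMultiplication.Theses.DesignFlattening

open Literature.Computability.AlgebraicComplexity

namespace Summit.MatrixMultiplication.MatrixMultiplication.Theorems

/-- Refutes `DesignFlattening.SeparableDesignsMultiplicative` [refuted-substantive]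
(stmt-MatrixMultiplication-8036): a separable `3`-term toric design of `xyz ⊗ xyz` over the `ℤ₃`
table exists (entries in `ℚ(√-3)`), so `k ≥ 2^N` fails at `N = 2` (the card's open bit
`N_sep(2) ∈ {3,4}` is `3`). Witness: the integral identity `key` over `ℤ[√-3]` (by `decide`) pushed
to `ℂ` along `√-3 ↦ i√3`. No cheap repair: tensoring the witness gives separable `3^M`-term designs
of `xyz^{⊗2M}`, so the term count grows at rate `√3 < 2` for every even `N` — neither an `N ≥ N₀`
side condition nor an asymptotic-rate-`2` restatement survives, and the sharper support
`SeparableTorusFloor` (rate `3/2`) is untouched; only a different (non-separable / real-entry) design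
notion could be multiplicative, which is a new statement, not a repair.
barrier-candidate: separable toric `ℤ₃`-designs of `xyz^{⊗N}` need at most `3^{⌈N/2⌉}` terms, so
term-count lower bounds for separable designs cap at growth rate `√3`. [folklore] -/
theorem DesignFlatteningSeparableDesignsMultiplicative_refuted :
    ¬ Summit.MatrixMultiplication.MatrixMultiplication.Theses.DesignFlattening.SeparableDesignsMultiplicative := by
  intro h
  -- the integral data (first / second / third factors, scaled by 12 / 42 / 168)
  let U : Fin 3 → Fin 2 → Fin 3 → ℤ√(-3) :=
    ![![![⟨0, 0⟩, ⟨12, 0⟩, ⟨6, 0⟩], ![⟨12, 0⟩, ⟨-6, 0⟩, ⟨-6, 6⟩]],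
      ![![⟨12, 0⟩, ⟨12, 0⟩, ⟨6, 0⟩], ![⟨6, -2⟩, ⟨-6, 0⟩, ⟨12, 0⟩]],
      ![![⟨12, 0⟩, ⟨6, 10⟩, ⟨3, 5⟩], ![⟨12, 0⟩, ⟨6, 0⟩, ⟨-12, 0⟩]]]
  let V : Fin 3 → Fin 2 → Fin 3 → ℤ√(-3) :=
    ![![![⟨42, 0⟩, ⟨-42, 0⟩, ⟨-21, 0⟩], ![⟨42, 0⟩, ⟨-21, 0⟩, ⟨-21, 21⟩]],
      ![![⟨0, 0⟩, ⟨42, 0⟩, ⟨21, 0⟩], ![⟨21, -7⟩, ⟨-21, 0⟩, ⟨42, 0⟩]],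
      ![![⟨-33, -15⟩, ⟨42, 0⟩, ⟨21, 0⟩], ![⟨-42, 0⟩, ⟨-21, 0⟩, ⟨42, 0⟩]]]
  let W : Fin 3 → Fin 2 → Fin 3 → ℤ√(-3) :=
    ![![![⟨288, 192⟩, ⟨336, -336⟩, ⟨168, -168⟩], ![⟨0, 56⟩, ⟨84, 0⟩, ⟨84, -84⟩]],
      ![![⟨1440, 288⟩, ⟨1440, -288⟩, ⟨720, -144⟩], ![⟨-84, 0⟩, ⟨21, 7⟩, ⟨-42, -14⟩]],
      ![![⟨0, 0⟩, ⟨-216, -24⟩, ⟨-108, -12⟩], ![⟨0, -112⟩, ⟨-168, 0⟩, ⟨336, 0⟩]]]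
  let term : Fin 3 → Fin 2 → Fin 3 → Fin 3 → Fin 3 → ℤ√(-3) := fun j i a b c =>
    (if a + b + c = 0 then 1 else 0) * U j i a * V j i b * W j i c
  -- the design identity over ℤ[√-3], on all 3⁶ entries
  have key : ∀ a0 b0 c0 a1 b1 c1 : Fin 3,
      (⟨7169347584, 0⟩ : ℤ√(-3)) * (xyzTensor (ℤ√(-3)) a0 b0 c0 * xyzTensor (ℤ√(-3)) a1 b1 c1) =
        term 0 0 a0 b0 c0 * term 0 1 a1 b1 c1 + term 1 0 a0 b0 c0 * term 1 1 a1 b1 c1 +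
          term 2 0 a0 b0 c0 * term 2 1 a1 b1 c1 := by
    decide
  -- √-3 ↦ i√3
  let φ : ℤ√(-3) →+* ℂ := Zsqrtd.lift ⟨Complex.I * Real.sqrt 3, by
    have h3 : ((Real.sqrt 3 : ℝ) : ℂ) * (Real.sqrt 3 : ℂ) = 3 := by
      rw [← Complex.ofReal_mul, Real.mul_self_sqrt (by norm_num : (0:ℝ) ≤ 3)]; norm_num
    calc Complex.I * (Real.sqrt 3 : ℂ) * (Complex.I * Real.sqrt 3)
        = (Complex.I * Complex.I) * ((Real.sqrt 3 : ℂ) * Real.sqrt 3) := by ring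
      _ = ((-3 : ℤ) : ℂ) := by rw [Complex.I_mul_I, h3]; norm_num⟩
  have φ_xyz : ∀ a b c : Fin 3, φ (xyzTensor (ℤ√(-3)) a b c) = xyzTensor ℂ a b c := fun a b c => by
    simp only [xyzTensor_apply, apply_ite φ, map_one, map_zero]
  have φ_const : φ (⟨7169347584, 0⟩ : ℤ√(-3)) = (7169347584 : ℂ) := by
    simp only [φ, Zsqrtd.lift_apply_apply]
    push_cast
    ring
  -- the design over ℂ
  let u : Fin 3 → Fin 2 → Fin 3 → ℂ := fun j i s => φ (U j i s) / 12
  let v : Fin 3 → Fin 2 → Fin 3 → ℂ := fun j i s => φ (V j i s) / 42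
  let w : Fin 3 → Fin 2 → Fin 3 → ℂ := fun j i s => φ (W j i s) / 168
  have design : ∀ a b c : Fin 2 → Fin 3, kroneckerPow (xyzTensor ℂ) 2 a b c =
      ∑ j, ∏ i, ((if a i + b i + c i = 0 then (1 : ℂ) else 0) * u j i (a i) * v j i (b i) * w j i (c i)) := by
    intro a b c
    rw [kroneckerPow_apply, Fin.prod_univ_two, Fin.sum_univ_three]
    simp only [Fin.prod_univ_two]
    have hk := congrArg φ (key (a 0) (b 0) (c 0) (a 1) (b 1) (c 1))
    simp only [map_mul, map_add, term, apply_ite φ, map_one, map_zero, φ_xyz, φ_const] at hk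
    simp only [u, v, w]
    linear_combination (1 / 7169347584 : ℂ) * hk
  have h4 := h 2 3 u v w design
  norm_num at h4

end Summit.MatrixMultiplication.MatrixMultiplication.Theorems
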